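import Mathlib
import Summits.CriticalPhenomena.CardyFormulaZ2.Theorems.CardyMagicRigidityMagicFormulaTStubBandExpMoment
import Summits.CriticalPhenomena.CardyFormulaZ2.Theorems.CardyMagicRigidityMagicFormulaTStubBandFirstMoment
import Summits.CriticalPhenomena.CardyFormulaZ2.Theorems.CardyMagicRigidityMagicFormulaTStubBandCentring
import Summits.CriticalPhenomena.CardyFormulaZ2.Theorems.CardyMagicRigidityMagicFormulaTStubUVSplit
import Summits.CriticalPhenomena.CardyFormulaZ2.Theorems.CardyMagicRigidityMagicFormulaTStubUVSandwich
import Summits.CriticalPhenomena.CardyFormulaZ2.Theorems.CardyMagicRigidityMagicFormulaTStubUVAssembly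
import Summits.CriticalPhenomena.CardyFormulaZ2.Theorems.CardyMagicRigidityTransferContinuityReduction
import HarnessLib

/-!
# Small loops are negligible for the twisted nesting transform, uniformly in the mesh — BOTH lattices
# (crux `MagicFormulaT`, line `Sketch` v6: the UV half closed; hypotheses (Z) and (T) of `TransferContinuity`)

Crux `Summit.CriticalPhenomena.CardyFormulaZ2.Theses.CardyMagicRigidity.MagicFormulaT`
(stmt-CriticalPhenomena-4836), line `Sketch`, skeleton v6 (the UV split).  With the six lattice stubs landed
(`stub_bandExpMoment` p138445, `stub_bandFirstMoment` p138361, `stub_bandCentring`, `stub_uvSplit` p138210,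
`stub_uvSandwich` p138299, `stub_uvAssembly` p139185) this file records the UV theorem itself
(registered sub-goal `uvNegligible`):

**Theorem (`uvNegligible`).** For each of the two critical lattice loop ensembles `E ∈ {zEns, tEns}` (bond
percolation on `δℤ²`, site percolation on `δ𝕋`), every admissible density `f` (measurable, `|f| ≤ C`, `f = 0`
off `‖z‖ ≤ R`, `∫ f = 0`) and every `κ > 0`: for all small cut-offs `η` and then all small meshes `δ`,
`|Λ^{≥0}_δ(f) − Λ^{≥η}_δ(f)| ≤ κ`, where `Λ^{≥η}_δ(f) = E[∏_{diam u ≥ η} 2cos(∫_{W(u,·)≠0} f + π/3)]` is the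
transform truncated to the loops of trace-diameter `≥ η` (`truncNestingTransform`).  "Restricting to big loops
costs nothing in the limit" — the step Duminil-Copin–Kozlowski–Lammers–Manolescu (arXiv:2603.06268, §5 p. 37)
defer to their unreleased companion even on `ℤ²`; here on both lattices, from RSW/BK (keystone K6 of crux
4835), the chessboard multi-scale exponential moments, and the exact reflection/duality centring.

**Corollaries.** `smallLoops_negligible_bond` / `smallLoops_negligible_site` are hypotheses (Z) / (T) of
`transferContinuity_of_truncation` (item `TransferContinuity`, stmt-CriticalPhenomena-4838) VERBATIM, so that
item now follows from the truncated transfer (B) alone: `transferContinuity_of_truncatedTransfer`.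
-/

noncomputable section

namespace Summit.CriticalPhenomena.CardyFormulaZ2.Cruxes.MagicFormulaT.LineSketch

open MeasureTheory Filter Set
open scoped Real Topology BigOperators
open Literature.Probability.RandomPlanarGeometry Literature.Probability.Percolation
  Literature.Probability.LatticeModels
open Summit.CriticalPhenomena.CardyFormulaZ2.Cruxes.NestingRigidity.RingCloudTomography
  (LoopEnsemble tEns zEns latticeEnsembles tEns_mem zEns_mem)

/-- **UV: small loops are negligible for the twisted nesting transform, uniformly in the mesh, on BOTH critical
lattice loop ensembles** (registered sub-goal `uvNegligible` of crux stmt-CriticalPhenomena-4836). -/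
theorem uvNegligible : ∀ E ∈ latticeEnsembles, ∀ (f : ℂ → ℝ) (R C : ℝ), Measurable f → (∀ z, |f z| ≤ C) →
    (∀ z, R < ‖z‖ → f z = 0) → ∫ z, f z = 0 → ∀ κ : ℝ, 0 < κ →
    ∀ᶠ η in 𝓝[>] (0 : ℝ), ∀ᶠ δ in 𝓝[>] (0 : ℝ),
      |truncNestingTransform E.P (E.X δ) f 0 - truncNestingTransform E.P (E.X δ) f η| ≤ κ :=
  fun E hE ↦ stub_uvAssembly stub_bandExpMoment stub_bandFirstMoment stub_uvSplit stub_uvSandwich E hE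
    (stub_bandCentring E hE)

/-- **Hypothesis (Z) of `transferContinuity_of_truncation`, discharged**: small loops of critical bond-`ℤ²`
are negligible for the twisted nesting transform, uniformly in the mesh. -/
theorem smallLoops_negligible_bond : ∀ (f : ℂ → ℝ) (R C : ℝ), Measurable f → (∀ z, |f z| ≤ C) →
    (∀ z, R < ‖z‖ → f z = 0) → ∫ z, f z = 0 → ∀ κ : ℝ, 0 < κ →
    ∀ᶠ η in 𝓝[>] (0 : ℝ), ∀ᶠ δ in 𝓝[>] (0 : ℝ),
      |truncNestingTransform (bondPercolation (zdGraph 2) half) (bondLoopConfig δ 0) f 0 -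
        truncNestingTransform (bondPercolation (zdGraph 2) half) (bondLoopConfig δ 0) f η| ≤ κ :=
  uvNegligible zEns zEns_mem

/-- **Hypothesis (T) of `transferContinuity_of_truncation`, discharged**: small loops of critical site-`𝕋`
are negligible for the twisted nesting transform, uniformly in the mesh. -/
theorem smallLoops_negligible_site : ∀ (f : ℂ → ℝ) (R C : ℝ), Measurable f → (∀ z, |f z| ≤ C) →
    (∀ z, R < ‖z‖ → f z = 0) → ∫ z, f z = 0 → ∀ κ : ℝ, 0 < κ →
    ∀ᶠ η in 𝓝[>] (0 : ℝ), ∀ᶠ δ in 𝓝[>] (0 : ℝ),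
      |truncNestingTransform (triSitePercolation half) (siteLoopConfig δ) f 0 -
        truncNestingTransform (triSitePercolation half) (siteLoopConfig δ) f η| ≤ κ :=
  uvNegligible tEns tEns_mem

/-- **`TransferContinuity` (stmt-CriticalPhenomena-4838) now follows from the truncated transfer (B) alone**:
with (Z) and (T) discharged, only "transfer of the TRUNCATED transform along `X`" remains in
`transferContinuity_of_truncation`. -/
theorem transferContinuity_of_truncatedTransfer
    (hB : Theses.CardyMagicRigidity.LoopLimitZ2EqT → ∀ (f : ℂ → ℝ) (R C : ℝ), Measurable f →
      (∀ z, |f z| ≤ C) → (∀ z, R < ‖z‖ → f z = 0) → ∫ z, f z = 0 → ∀ κ : ℝ, 0 < κ →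
        ∃ᶠ η in 𝓝[>] (0 : ℝ), ∀ᶠ δ in 𝓝[>] (0 : ℝ),
          |truncNestingTransform (bondPercolation (zdGraph 2) half) (bondLoopConfig δ 0) f η -
            truncNestingTransform (triSitePercolation half) (siteLoopConfig δ) f η| ≤ κ) :
    Theses.CardyMagicRigidity.TransferContinuity :=
  Theorems.transferContinuity_of_truncation smallLoops_negligible_bond smallLoops_negligible_site hB

end Summit.CriticalPhenomena.CardyFormulaZ2.Cruxes.MagicFormulaT.LineSketch

end
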